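/-
Origin: expansion seat `planner-pub-hodgecm-pv10-0`, handover 2026-08-18 (`HOME/pub-hodgecm-pv10/lean/Pv10/ProperCriterion.lean`, md5 15cb4cb3, 126 lines);
landed by the gen-6 packager in gate run 22 as `HodgeCM/PerL34/ProperCriterion.lean` (verbatim).
-/
/-
Origin: planner-pub-hodgecm-pv10-0 (unit pub-hodgecm-pv10), HodgeCM publication cell, 2026-08-18.
Node N15 (PerL v5 §3.2, tex l. 311): the idele class group of `L₀` "injects continuously and
properly: norm-one classes are compact and `|·|_L = |·|²_{L₀}` on `𝔸^×_{L₀}`" — the two topological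
inferences behind PROPERLY, in abstract form, KERNEL (Mathlib only).
-/
import Mathlib.Topology.Maps.Proper.CompactlyGenerated
import Mathlib.Topology.Algebra.Group.Pointwise
import Mathlib.Topology.Algebra.Group.OpenMapping

/-!
# Properness criteria (node N15, "injects continuously and properly")

PerL's parenthetical proof that `ι : C_{L₀} → C_L` is proper consists of two inferences:

1. `MonoidHom.isProperMap_of_isCompact_ker`: a continuous SURJECTIVE homomorphism `N : A →* M` from a
   σ-compact group onto a Hausdorff Baire group (e.g. `ℝ_{>0}`) with COMPACT kernel is a proper map
   (open mapping theorem + closed·compact is closed) — "norm-one classes are compact" makes the norm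
   `|·|_{L₀} : C_{L₀} → ℝ_{>0}` proper;
2. `isProperMap_of_comp_factor`: if a proper map `NA : A → Z` factors as `g ∘ f` through a continuous
   `f : A → C` into a Hausdorff locally compact (compactly coherent) space and a continuous
   `g : C → Z`, then `f` is proper — with `NA = |·|_{L₀}`, `g = |·|_L^{1/2}`, this is
   "`|·|_L = |·|²_{L₀}` ⇒ ι proper".

The maps themselves (`C_{L₀} → C_L`, the idelic norms) are not constructed here (adelic base change and
the idelic norm are absent from Mathlib); compactness of `C¹_{L₀}` is a PRINT fact (finiteness of the
class number + Dirichlet's unit theorem).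
-/

set_option autoImplicit false

open Set Topology Pointwise

/-! ## 2. A map through which a proper map factors is proper -/

section Factor

variable {A C Z : Type*} [TopologicalSpace A] [TopologicalSpace C] [TopologicalSpace Z]

/-- **PerL l. 311 (`|·|_L = |·|²_{L₀}` ⇒ proper).**  If `NA = g ∘ f` with `NA` proper, `f`, `g`
continuous and `C` Hausdorff compactly coherent (e.g. locally compact), then `f` is proper. -/
theorem isProperMap_of_comp_factor [T2Space C] [CompactlyCoherentSpace C]
    {f : A → C} (hf : Continuous f) {NA : A → Z} (hNA : IsProperMap NA)
    {g : C → Z} (hg : Continuous g) (h : ∀ a, NA a = g (f a)) :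
    IsProperMap f := by
  rw [isProperMap_iff_isCompact_preimage]
  refine ⟨hf, fun K hK => ?_⟩
  have hsub : f ⁻¹' K ⊆ NA ⁻¹' (g '' K) := fun a ha => ⟨f a, ha, (h a).symm⟩
  exact (hNA.isCompact_preimage (hK.image hg)).of_isClosed_subset (hK.isClosed.preimage hf) hsub

end Factor

/-! ## 1. Surjective homomorphisms with compact kernel -/

namespace MonoidHom

variable {A M : Type*} [Group A] [TopologicalSpace A] [IsTopologicalGroup A]
  [Group M] [TopologicalSpace M]

/-- An OPEN continuous surjective homomorphism with compact kernel is a proper map. -/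
theorem isProperMap_of_isOpenMap_of_isCompact_ker (N : A →* M) (hc : Continuous N)
    (ho : IsOpenMap N) (hs : Function.Surjective N) (hK : IsCompact (N.ker : Set A)) :
    IsProperMap N := by
  rw [isProperMap_iff_isClosedMap_and_compact_fibers]
  refine ⟨hc, ?_, ?_⟩
  · -- closed map: `N ⁻¹' (N '' F) = F * ker N` is closed, and `N` is a quotient map
    intro F hF
    have hq : IsQuotientMap N := ho.isQuotientMap hc hs
    rw [hq.isClosed_preimage.symm]
    have hFK : (N : A → M) ⁻¹' (N '' F) = F * (N.ker : Set A) := by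
      ext a
      constructor
      · rintro ⟨b, hb, hba⟩
        refine Set.mem_mul.mpr ⟨b, hb, b⁻¹ * a, ?_, mul_inv_cancel_left b a⟩
        show b⁻¹ * a ∈ N.ker
        rw [mem_ker, map_mul, map_inv, hba, inv_mul_cancel]
      · intro ha
        obtain ⟨b, hb, k, hk, rfl⟩ := Set.mem_mul.mp ha
        refine ⟨b, hb, ?_⟩
        rw [map_mul, show N k = 1 from hk, mul_one]
    rw [hFK]
    exact hF.mul_right_of_isCompact hK
  · -- fibres are cosets of the kernel
    intro m
    obtain ⟨a, rfl⟩ := hs m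
    have hfib : (N : A → M) ⁻¹' {N a} = a • (N.ker : Set A) := by
      ext x
      rw [Set.mem_preimage, Set.mem_singleton_iff, Set.mem_smul_set]
      constructor
      · intro hx
        refine ⟨a⁻¹ * x, ?_, by simp⟩
        show a⁻¹ * x ∈ N.ker
        rw [mem_ker, map_mul, map_inv, hx, inv_mul_cancel]
      · rintro ⟨k, hk, rfl⟩
        rw [smul_eq_mul, map_mul, show N k = 1 from hk, mul_one]
    rw [hfib]
    exact hK.smul a

/-- **PerL l. 311 ("norm-one classes are compact" ⇒ the norm is proper).**  A continuous surjective
homomorphism from a σ-compact Hausdorff group onto a Hausdorff Baire group (e.g. a locally compact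
group such as `ℝ_{>0}`) with compact kernel is a proper map. -/
theorem isProperMap_of_isCompact_ker [T2Space A] [SigmaCompactSpace A]
    [T2Space M] [BaireSpace M] [IsTopologicalGroup M]
    (N : A →* M) (hc : Continuous N) (hs : Function.Surjective N)
    (hK : IsCompact (N.ker : Set A)) : IsProperMap N :=
  N.isProperMap_of_isOpenMap_of_isCompact_ker hc (N.isOpenMap_of_sigmaCompact hs hc) hs hK

end MonoidHom

/-! ## The two steps combined -/

/-- **PerL l. 311, both inferences.**  `ι : A → C` continuous homomorphism-or-not, `NA : A →* P`
a continuous surjective "norm" with compact kernel on a σ-compact Hausdorff group `A`, `NC : C → P`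
continuous with `NC ∘ ι = φ ∘ NA` for a homeomorphism `φ` of `P` (squaring on `ℝ_{>0}`):
then `ι` is proper. -/
theorem isProperMap_of_norms {A C P : Type*} [Group A] [TopologicalSpace A] [IsTopologicalGroup A]
    [T2Space A] [SigmaCompactSpace A] [TopologicalSpace C] [T2Space C] [CompactlyCoherentSpace C]
    [Group P] [TopologicalSpace P] [T2Space P] [BaireSpace P] [IsTopologicalGroup P]
    {ι : A → C} (hι : Continuous ι) (NA : A →* P) (hNA : Continuous NA)
    (hNAs : Function.Surjective NA) (hNA1 : IsCompact (NA.ker : Set A))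
    {NC : C → P} (hNC : Continuous NC) (φ : P ≃ₜ P) (h : ∀ a, NC (ι a) = φ (NA a)) :
    IsProperMap ι := by
  have hp : IsProperMap NA := NA.isProperMap_of_isCompact_ker hNA hNAs hNA1
  refine isProperMap_of_comp_factor hι hp (g := fun c => φ.symm (NC c))
    (φ.symm.continuous.comp hNC) fun a => ?_
  simp [h a]
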